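import Mathlib
import HarnessLib
import Literature.Probability.LatticeModels.CriticalFKIsingConnectionLaws

/-!
# The thermodynamic limit of the critical FK-Ising connection laws of general probes along boxes

Topic `Literature/Probability/LatticeModels`. For the wired FK-Ising random-cluster measure
`φ¹_{Λ_L}` of the centred boxes `Λ_L = [-L, L]^d` of `ℤ^d` at `p = 1 - e^{-2β_c(d)}`, `q = 2`,
`d ≥ 3`, and finitely many ARBITRARY probe sets `K i ⊆ ℤ^d` such that any two infinite probes
meet, the law of the open-path connection relation among the probes (`i ~ j` iff some `x ∈ K i`,
`y ∈ K j` of the box are joined by an open path of the box) converges as `L → ∞`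
(`tendsto_rcMeasure_real_connRelLaw_criticalBeta_of_inter`).

The sibling file `CriticalFKIsingConnectionLaws` proves this for probes each finite or co-finite
(Grimmett 2006, Thm. (4.19), wired limit, plus the vanishing of the wired arm at `p_c(2)`, `d ≥ 3`).
The reduction of general probes to finite ones is the event inclusion of Grimmett 2006, proof of
Prop. (5.11): truncating every probe to `Λ_N` changes the connection relation in `Λ_L ⊇ Λ_N` only
if some point of a finite probe (all inside `Λ_{N₀}`) is joined by an open path to a point outside
`Λ_N`, which forces an open path of `Λ_N` from a point of `Λ_{N₀}` to `∂Λ_N`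
(`connRelLaw_symmDiff_truncate_subset`); two infinite probes are joined anyway through a common
point. By the monotonicity of the wired measures in the domain (Grimmett 2006, eq. (4.24)) the
`φ¹_{Λ_L}`-probability of that arm event is at most its `φ¹_{Λ_N}`-probability, which tends to `0`
as `N → ∞` (`CriticalFKIsingArmVanishes`), uniformly in `L ≥ N` (`abs_connRelLaw_sub_truncate_le`);
a sequence that is, for every `ε`, eventually `ε`-close to a convergent sequence converges
(`exists_tendsto_of_forall_eventually_abs_sub_le`).

Also recorded: the centred-box (`v = 0`) forms of the sibling files' translated-box statements
(`tendsto_rcMeasure_real_connRelLaw_criticalBeta_box`,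
`tendsto_rcMeasure_real_siteArm_criticalBeta_box`) and the path lemma
`reachable_finsetRestrict_or_exists_wiredBoundary` (an open path of `Δ ⊇ Λ` from a point of `Λ`
either stays in `E_Λ` or reaches `∂Λ` inside `Λ`).

Used by the route `CriticalPhenomena/Ising3DConformalLimit/ArmDressing` (support
`InfiniteVolumeEdwardsSokal`, clause (a)). Not here: the limit as a measure; rates of convergence.
Events are written out in full (no notation): the wired measure of the piece `S` is
`rcMeasure (finsetGraph (zdGraph d) S) p q (wiredBoundary (zdGraph d) S)`.

## References

* G. Grimmett, *The Random-Cluster Model* (2006), Thm. (4.19) and its proof, eq. (4.24),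
  Prop. (5.11) and its proof. [Grimmett2006]
* M. Aizenman, H. Duminil-Copin, V. Sidoravicius, Comm. Math. Phys. 334 (2015), Thm. 1.2.
  [AizenmanDuminilCopinSidoraviciusCMP2015]
-/

noncomputable section

namespace Literature.Probability.LatticeModels

open _root_.MeasureTheory Finset SimpleGraph Filter _root_.Topology
open scoped symmDiff
open Literature.Probability.Percolation

/-! ### Open paths leaving a sub-piece pass its inner boundary -/

section BoundaryPath

variable {V : Type*} [DecidableEq V] {G : SimpleGraph V} [G.LocallyFinite] {Λ Δ : Finset V}
  (h : Λ ⊆ Δ)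

/-- **An open path from a point of `Λ ⊆ Δ` either stays inside `Λ` or reaches `∂Λ` inside `Λ`.**
Let `ω ⊆ E_Δ` and let `x ∈ Λ` be joined to `y ∈ Δ` by an `ω`-open path. Then either `y ∈ Λ` and
`x` is joined to `y` by a path open in the restriction of `ω` to `E_Λ`, or `x` is joined to a vertex
of `∂Λ` by such a path (follow the path until it first leaves `Λ`).
[cite: Grimmett2006, Prop. (5.11) (proof)] -/
theorem reachable_finsetRestrict_or_exists_wiredBoundary {ω : BondConfig Δ}
    (hω : ω ⊆ (finsetGraph G Δ).edgeSet) {x : Λ} {y : Δ}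
    (hxy : (openGraph ω).Reachable (finsetIncl h x) y) :
    (∃ a : Λ, finsetIncl h a = y ∧ (openGraph (finsetRestrict h ω)).Reachable x a) ∨
      ∃ z : Λ, z ∈ wiredBoundary G Λ ∧ (openGraph (finsetRestrict h ω)).Reachable x z := by
  by_contra hcon
  rw [not_or] at hcon
  obtain ⟨hnoy, hno'⟩ := hcon
  have hno : ∀ a : Λ, a.1 ∈ innerBoundary G Λ →
      ¬(openGraph (finsetRestrict h ω)).Reachable x a :=
    fun a hb ha => hno' ⟨a, hb, ha⟩
  -- `P v`: `v` is the image of a vertex of `Λ` joined to `x` in the restriction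
  set P : Δ → Prop := fun v => ∃ a : Λ, finsetIncl h a = v ∧
    (openGraph (finsetRestrict h ω)).Reachable x a with hP
  have hstep : ∀ u v : Δ, P u → (openGraph ω).Adj u v → P v := by
    rintro u v ⟨a, rfl, ha⟩ huv
    -- `a` is not on `∂Λ`, so its neighbour `v` lies in `Λ`
    have hadj : G.Adj a.1 v.1 := by
      have := hω ((openGraph_adj ω _ _).1 huv).1
      exact this
    have hvΛ : v.1 ∈ Λ := by
      by_contra hv
      exact hno a (mem_innerBoundary_iff.2 ⟨a.2, v.1, hv, hadj⟩) ha
    refine ⟨⟨v.1, hvΛ⟩, rfl, ha.trans (Adj.reachable ?_)⟩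
    rw [openGraph_finsetRestrict_adj]
    exact huv
  refine hnoy ?_
  obtain ⟨w⟩ := hxy
  -- walk induction from `finsetIncl h x`
  suffices ∀ u : Δ, P u → ∀ v : Δ, (openGraph ω).Walk u v → P v from
    this _ ⟨x, rfl, Reachable.refl _⟩ _ w
  intro u hu v w'
  induction w' with
  | nil => exact hu
  | cons hadj _ ih => exact ih (hstep _ _ hu hadj)

/-- **Open paths leaving `Λ` pass `∂Λ`**: if `ω ⊆ E_Δ` joins `x ∈ Λ` to a vertex `y ∉ Λ` of
`Δ ⊇ Λ` by an open path, then `x` is joined to `∂Λ` by a path open in the restriction of `ω` to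
`E_Λ`. [cite: Grimmett2006, Prop. (5.11) (proof)] -/
theorem exists_reachable_wiredBoundary_restrict_of_notMem {ω : BondConfig Δ}
    (hω : ω ⊆ (finsetGraph G Δ).edgeSet) {x : Λ} {y : Δ} (hy : y.1 ∉ Λ)
    (hxy : (openGraph ω).Reachable (finsetIncl h x) y) :
    ∃ z : Λ, z ∈ wiredBoundary G Λ ∧ (openGraph (finsetRestrict h ω)).Reachable x z := by
  rcases reachable_finsetRestrict_or_exists_wiredBoundary h hω hxy with ⟨a, hay, -⟩ | h'
  · exfalso
    apply hy
    rw [← hay]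
    exact a.2
  · exact h'

end BoundaryPath

/-! ### A real sequence eventually `ε`-close to convergent sequences converges -/

/-- If for every `ε > 0` the real sequence `f` is eventually within `ε` of some convergent
sequence, then `f` converges (it is Cauchy). [folklore] -/
theorem exists_tendsto_of_forall_eventually_abs_sub_le {f : ℕ → ℝ}
    (h : ∀ ε > 0, ∃ g : ℕ → ℝ, (∃ a, Tendsto g atTop (𝓝 a)) ∧ ∀ᶠ n in atTop, |f n - g n| ≤ ε) :
    ∃ l, Tendsto f atTop (𝓝 l) := by
  refine cauchySeq_tendsto_of_complete (Metric.cauchySeq_iff.2 fun ε hε => ?_)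
  obtain ⟨g, ⟨a, hg⟩, hfg⟩ := h (ε / 3) (by positivity)
  obtain ⟨N₁, hN₁⟩ := Metric.cauchySeq_iff.1 hg.cauchySeq (ε / 3) (by positivity)
  obtain ⟨N₂, hN₂⟩ := eventually_atTop.1 hfg
  refine ⟨max N₁ N₂, fun m hm n hn => ?_⟩
  have h1 := hN₁ m (le_of_max_le_left hm) n (le_of_max_le_left hn)
  have h2 := hN₂ m (le_of_max_le_right hm)
  have h3 := hN₂ n (le_of_max_le_right hn)
  rw [Real.dist_eq] at h1 ⊢
  calc |f m - f n| = |f m - g m + (g m - g n) + (g n - f n)| := by ring_nf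
    _ ≤ |f m - g m| + |g m - g n| + |g n - f n| := abs_add_three _ _ _
    _ < ε := by rw [abs_sub_comm (g n) (f n)]; linarith

/-! ### Centred boxes: the sibling files' statements at `v = 0` -/

section Box

variable {d : ℕ}

/-- **Thermodynamic limit of the connection laws along centred boxes, finite or co-finite probes**
(the `v = 0` case of `tendsto_rcMeasure_real_connRelLaw_criticalBeta`, transported along
`Λ_L = Λ_L + 0`). [cite: Grimmett2006, Thm. (4.19), proof] -/
theorem tendsto_rcMeasure_real_connRelLaw_criticalBeta_box (hd : 3 ≤ d) {m : ℕ}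
    {K : Fin m → Set (Site d)} (hK : ∀ i, (K i).Finite ∨ (K i)ᶜ.Finite)
    (R : Set (Fin m → Fin m → Prop)) :
    ∃ ℓ : ℝ, Tendsto (fun L : ℕ =>
      (rcMeasure (finsetGraph (zdGraph d) (box d L)) (fkIsingParam (criticalBeta d)) 2
        (wiredBoundary (zdGraph d) (box d L))).real
        {ω | (fun i j => ∃ x y : ↥(box d L), x.1 ∈ K i ∧ y.1 ∈ K j ∧
          (openGraph ω).Reachable x y) ∈ R}) atTop (𝓝 ℓ) := by
  obtain ⟨ℓ, hℓ⟩ := tendsto_rcMeasure_real_connRelLaw_criticalBeta hd hK R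
  refine ⟨ℓ, (hℓ 0).congr fun L => ?_⟩
  exact congrArg (fun S : Finset (Site d) =>
    (rcMeasure (finsetGraph (zdGraph d) S) (fkIsingParam (criticalBeta d)) 2
      (wiredBoundary (zdGraph d) S)).real
      {ω | (fun i j => ∃ x y : ↥S, x.1 ∈ K i ∧ y.1 ∈ K j ∧ (openGraph ω).Reachable x y) ∈ R})
    (box_eq_icc_shift_zero L).symm

/-- **The arm to the boundary vanishes along centred boxes** at `p = 1 - e^{-2β_c(d)}`, `q = 2`,
`d ≥ 3`: `φ¹_{Λ_L}(x ↔ ∂Λ_L) → 0` for every lattice point `x` (the `v = 0` case of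
`tendsto_rcMeasure_real_siteArm_criticalBeta`).
[cite: AizenmanDuminilCopinSidoraviciusCMP2015, Thm. 1.2 with Cor. 1.5 (1)] -/
theorem tendsto_rcMeasure_real_siteArm_criticalBeta_box (hd : 3 ≤ d) (x : Site d) :
    Tendsto (fun L : ℕ =>
      (rcMeasure (finsetGraph (zdGraph d) (box d L)) (fkIsingParam (criticalBeta d)) 2
        (wiredBoundary (zdGraph d) (box d L))).real
        {ω | ∃ a y : ↥(box d L), a.1 = x ∧ y ∈ wiredBoundary (zdGraph d) (box d L) ∧
          (openGraph ω).Reachable a y}) atTop (𝓝 0) := by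
  refine (tendsto_rcMeasure_real_siteArm_criticalBeta hd 0 x).congr fun L => ?_
  exact congrArg (fun S : Finset (Site d) =>
    (rcMeasure (finsetGraph (zdGraph d) S) (fkIsingParam (criticalBeta d)) 2
      (wiredBoundary (zdGraph d) S)).real
      {ω | ∃ a y : ↥S, a.1 = x ∧ y ∈ wiredBoundary (zdGraph d) S ∧ (openGraph ω).Reachable a y})
    (box_eq_icc_shift_zero L).symm

/-! ### Truncating the probes to `Λ_N`: the error is an arm event of `Λ_N` -/

/-- **Truncation changes the connection relation only through an arm of `Λ_N`** (the event
inclusion of Grimmett 2006, proof of Prop. (5.11)): let every finite probe lie in `Λ_{N₀}` and any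
two infinite probes share a point of `Λ_{N₀}`, and let `N₀ ≤ N ≤ L`. If a configuration
`ω ⊆ E_{Λ_L}` lies in exactly one of the law events of `K` and of the truncated family
`(K i ∩ Λ_N)_i`, then some point of `Λ_{N₀}` is joined to `∂Λ_N` by a path of `Λ_N` open in the
restriction of `ω` to `E_{Λ_N}`. [cite: Grimmett2006, Prop. (5.11) (proof)] -/
theorem connRelLaw_symmDiff_truncate_subset {m : ℕ} {K : Fin m → Set (Site d)} {N₀ N L : ℕ}
    (hfin : ∀ i, (K i).Finite → K i ⊆ ↑(box d N₀))
    (hinf : ∀ i j, (K i).Infinite → (K j).Infinite → (K i ∩ K j ∩ ↑(box d N₀)).Nonempty)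
    (hN : N₀ ≤ N) (hNL : N ≤ L) (R : Set (Fin m → Fin m → Prop)) {ω : BondConfig ↥(box d L)}
    (hω : ω ⊆ (finsetGraph (zdGraph d) (box d L)).edgeSet)
    (hmem : ω ∈
      {ω : BondConfig ↥(box d L) | (fun i j => ∃ x y : ↥(box d L), x.1 ∈ K i ∧ y.1 ∈ K j ∧
        (openGraph ω).Reachable x y) ∈ R} ∆
      {ω : BondConfig ↥(box d L) | (fun i j => ∃ x y : ↥(box d L),
        x.1 ∈ K i ∩ ↑(box d N) ∧ y.1 ∈ K j ∩ ↑(box d N) ∧ (openGraph ω).Reachable x y) ∈ R}) :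
    ω ∈ ⋃ x ∈ box d N₀, finsetRestrict (box_mono d hNL) ⁻¹'
      {ξ : BondConfig ↥(box d N) | ∃ a y : ↥(box d N), a.1 = x ∧
        y ∈ wiredBoundary (zdGraph d) (box d N) ∧ (openGraph ξ).Reachable a y} := by
  by_contra hnot
  -- truncated connections are connections
  have hsub : ∀ i j, (∃ x y : ↥(box d L), x.1 ∈ K i ∩ ↑(box d N) ∧ y.1 ∈ K j ∩ ↑(box d N) ∧
      (openGraph ω).Reachable x y) →
      ∃ x y : ↥(box d L), x.1 ∈ K i ∧ y.1 ∈ K j ∧ (openGraph ω).Reachable x y :=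
    fun i j ⟨x, y, hx, hy, hxy⟩ => ⟨x, y, hx.1, hy.1, hxy⟩
  -- conversely, off the arm events, connections are truncated connections
  have key : ∀ i j, (∃ x y : ↥(box d L), x.1 ∈ K i ∧ y.1 ∈ K j ∧ (openGraph ω).Reachable x y) →
      ∃ x y : ↥(box d L), x.1 ∈ K i ∩ ↑(box d N) ∧ y.1 ∈ K j ∩ ↑(box d N) ∧
        (openGraph ω).Reachable x y := by
    rintro i j ⟨x, y, hx, hy, hxy⟩
    by_cases hi : (K i).Finite
    · have hxN : x.1 ∈ box d N := box_mono d hN (hfin i hi hx)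
      by_cases hyN : y.1 ∈ box d N
      · exact ⟨x, y, ⟨hx, hxN⟩, ⟨hy, hyN⟩, hxy⟩
      · -- the path from `x ∈ Λ_{N₀}` leaves `Λ_N`: an arm at `x`
        exfalso
        refine hnot (Set.mem_iUnion₂.2 ⟨x.1, hfin i hi hx, ?_⟩)
        obtain ⟨z, hz, hxz⟩ := exists_reachable_wiredBoundary_restrict_of_notMem (box_mono d hNL)
          hω (x := ⟨x.1, hxN⟩) hyN hxy
        exact ⟨⟨x.1, hxN⟩, z, rfl, hz, hxz⟩
    · by_cases hj : (K j).Finite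
      · have hyN : y.1 ∈ box d N := box_mono d hN (hfin j hj hy)
        by_cases hxN : x.1 ∈ box d N
        · exact ⟨x, y, ⟨hx, hxN⟩, ⟨hy, hyN⟩, hxy⟩
        · -- the path from `y ∈ Λ_{N₀}` leaves `Λ_N`: an arm at `y`
          exfalso
          refine hnot (Set.mem_iUnion₂.2 ⟨y.1, hfin j hj hy, ?_⟩)
          obtain ⟨z, hz, hyz⟩ := exists_reachable_wiredBoundary_restrict_of_notMem (box_mono d hNL)
            hω (x := ⟨y.1, hyN⟩) hxN hxy.symm
          exact ⟨⟨y.1, hyN⟩, z, rfl, hz, hyz⟩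
      · -- two infinite probes share a point of `Λ_{N₀} ⊆ Λ_N ⊆ Λ_L`
        obtain ⟨z, ⟨hzi, hzj⟩, hzN₀⟩ := hinf i j hi hj
        have hzN : z ∈ box d N := box_mono d hN hzN₀
        have hzL : z ∈ box d L := box_mono d hNL hzN
        exact ⟨⟨z, hzL⟩, ⟨z, hzL⟩, ⟨hzi, hzN⟩, ⟨hzj, hzN⟩, Reachable.refl _⟩
  have heq : (fun i j => ∃ x y : ↥(box d L), x.1 ∈ K i ∧ y.1 ∈ K j ∧ (openGraph ω).Reachable x y) =
      fun i j => ∃ x y : ↥(box d L), x.1 ∈ K i ∩ ↑(box d N) ∧ y.1 ∈ K j ∩ ↑(box d N) ∧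
        (openGraph ω).Reachable x y := by
    funext i j
    exact propext ⟨key i j, hsub i j⟩
  rw [Set.mem_symmDiff, Set.mem_setOf_eq, Set.mem_setOf_eq, heq] at hmem
  tauto

/-- **The truncation error is at most a sum of arm probabilities of `Λ_N`**, uniformly in the
box: under the hypotheses of `connRelLaw_symmDiff_truncate_subset`, for `0 ≤ p ≤ 1`, `q ≥ 1`,
`d ≥ 1`,
`|φ¹_{Λ_L}(law of K ∈ R) - φ¹_{Λ_L}(law of (K i ∩ Λ_N)_i ∈ R)| ≤ ∑_{x ∈ Λ_{N₀}} φ¹_{Λ_N}(x ↔ ∂Λ_N)`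
(the arm events are increasing events of `E_{Λ_N}`, so their `φ¹_{Λ_L}`-probability is at most
their `φ¹_{Λ_N}`-probability, Grimmett 2006, eq. (4.24)).
[cite: Grimmett2006, Thm. (4.19)(a), proof, eq. (4.24)] -/
theorem abs_connRelLaw_sub_truncate_le (hd : 0 < d) {p q : ℝ} (hp : p ∈ Set.Icc (0 : ℝ) 1)
    (hq : 1 ≤ q) {m : ℕ} {K : Fin m → Set (Site d)} {N₀ N L : ℕ}
    (hfin : ∀ i, (K i).Finite → K i ⊆ ↑(box d N₀))
    (hinf : ∀ i j, (K i).Infinite → (K j).Infinite → (K i ∩ K j ∩ ↑(box d N₀)).Nonempty)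
    (hN : N₀ ≤ N) (hNL : N ≤ L) (R : Set (Fin m → Fin m → Prop)) :
    |(rcMeasure (finsetGraph (zdGraph d) (box d L)) p q (wiredBoundary (zdGraph d) (box d L))).real
        {ω | (fun i j => ∃ x y : ↥(box d L), x.1 ∈ K i ∧ y.1 ∈ K j ∧
          (openGraph ω).Reachable x y) ∈ R} -
      (rcMeasure (finsetGraph (zdGraph d) (box d L)) p q (wiredBoundary (zdGraph d) (box d L))).real
        {ω | (fun i j => ∃ x y : ↥(box d L), x.1 ∈ K i ∩ ↑(box d N) ∧ y.1 ∈ K j ∩ ↑(box d N) ∧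
          (openGraph ω).Reachable x y) ∈ R}| ≤
      ∑ x ∈ box d N₀, (rcMeasure (finsetGraph (zdGraph d) (box d N)) p q
          (wiredBoundary (zdGraph d) (box d N))).real
          {ξ | ∃ a y : ↥(box d N), a.1 = x ∧ y ∈ wiredBoundary (zdGraph d) (box d N) ∧
            (openGraph ξ).Reachable a y} := by
  have hq0 : 0 < q := one_pos.trans_le hq
  haveI : IsProbabilityMeasure
      (rcMeasure (finsetGraph (zdGraph d) (box d L)) p q (wiredBoundary (zdGraph d) (box d L))) :=
    isProbabilityMeasure_rcMeasure _ hp hq0 _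
  calc _ ≤ (rcMeasure (finsetGraph (zdGraph d) (box d L)) p q
        (wiredBoundary (zdGraph d) (box d L))).real
        ({ω : BondConfig ↥(box d L) | (fun i j => ∃ x y : ↥(box d L), x.1 ∈ K i ∧ y.1 ∈ K j ∧
          (openGraph ω).Reachable x y) ∈ R} ∆
        {ω : BondConfig ↥(box d L) | (fun i j => ∃ x y : ↥(box d L),
          x.1 ∈ K i ∩ ↑(box d N) ∧ y.1 ∈ K j ∩ ↑(box d N) ∧ (openGraph ω).Reachable x y) ∈ R}) :=
        abs_measureReal_sub_le_measureReal_symmDiff (Set.toFinite _).measurableSet.nullMeasurableSet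
          (Set.toFinite _).measurableSet.nullMeasurableSet
    _ ≤ (rcMeasure (finsetGraph (zdGraph d) (box d L)) p q
        (wiredBoundary (zdGraph d) (box d L))).real
        (⋃ x ∈ box d N₀, finsetRestrict (box_mono d hNL) ⁻¹'
          {ξ : BondConfig ↥(box d N) | ∃ a y : ↥(box d N), a.1 = x ∧
            y ∈ wiredBoundary (zdGraph d) (box d N) ∧ (openGraph ξ).Reachable a y}) :=
        rcMeasure_real_mono_on_edgeSets _ hp hq0 _
          (fun ω hω hmem => connRelLaw_symmDiff_truncate_subset hfin hinf hN hNL R hω hmem)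
    _ ≤ ∑ x ∈ box d N₀, (rcMeasure (finsetGraph (zdGraph d) (box d L)) p q
          (wiredBoundary (zdGraph d) (box d L))).real
          (finsetRestrict (box_mono d hNL) ⁻¹'
            {ξ : BondConfig ↥(box d N) | ∃ a y : ↥(box d N), a.1 = x ∧
              y ∈ wiredBoundary (zdGraph d) (box d N) ∧ (openGraph ξ).Reachable a y}) :=
        measureReal_biUnion_finset_le _ _
    _ ≤ _ := Finset.sum_le_sum fun x _ =>
        rcMeasure_real_box_restrict_le hd hNL hp hq (isUpperSet_siteArmEvent _ x)

/-! ### The thermodynamic limit for general probes -/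

/-- **Thermodynamic limit of the critical FK-Ising connection laws along boxes, general probes**:
for `p = 1 - e^{-2β_c(d)}`, `q = 2`, `d ≥ 3`, finitely many probes `K i ⊆ ℤ^d` such that any two
infinite probes with distinct indices meet, and every set `R` of relations, the
`φ¹_{Λ_L}`-probability that the open-path connection relation among the probes lies in `R`
converges as `L → ∞` (Grimmett 2006, Thm. (4.19) for the wired limit of the truncated, finite
probes; the truncation error is a wired arm probability, which vanishes at `p_c(2)`, `d ≥ 3`, by
the continuity of the magnetisation, Aizenman–Duminil-Copin–Sidoravicius 2015).
[cite: Grimmett2006, Thm. (4.19) and Prop. (5.11), proofs] -/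
theorem tendsto_rcMeasure_real_connRelLaw_criticalBeta_of_inter (hd : 3 ≤ d) {m : ℕ}
    {K : Fin m → Set (Site d)}
    (hK : ∀ i j, i ≠ j → (K i).Infinite → (K j).Infinite → (K i ∩ K j).Nonempty)
    (R : Set (Fin m → Fin m → Prop)) :
    ∃ ℓ : ℝ, Tendsto (fun L : ℕ =>
      (rcMeasure (finsetGraph (zdGraph d) (box d L)) (fkIsingParam (criticalBeta d)) 2
        (wiredBoundary (zdGraph d) (box d L))).real
        {ω | (fun i j => ∃ x y : ↥(box d L), x.1 ∈ K i ∧ y.1 ∈ K j ∧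
          (openGraph ω).Reachable x y) ∈ R}) atTop (𝓝 ℓ) := by
  have hd0 : 0 < d := by omega
  have hp : fkIsingParam (criticalBeta d) ∈ Set.Icc (0 : ℝ) 1 :=
    fkIsingParam_mem_Icc (criticalBeta_nonneg d)
  -- radii of the finite probes
  have h1 : ∀ i, ∃ r : ℕ, (K i).Finite → K i ⊆ ↑(box d r) := fun i => by
    by_cases h : (K i).Finite
    · obtain ⟨r, hr⟩ := exists_subset_box_of_set_finite h
      exact ⟨r, fun _ => hr⟩
    · exact ⟨0, fun h' => absurd h' h⟩
  choose r hr using h1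
  -- common points of pairs of infinite probes
  have h2 : ∀ i j, ∃ z : Site d, (K i).Infinite → (K j).Infinite → z ∈ K i ∩ K j := fun i j => by
    by_cases hi : (K i).Infinite
    · by_cases hj : (K j).Infinite
      · by_cases hij : i = j
        · subst hij
          obtain ⟨z, hz⟩ := hi.nonempty
          exact ⟨z, fun _ _ => ⟨hz, hz⟩⟩
        · obtain ⟨z, hz⟩ := hK i j hij hi hj
          exact ⟨z, fun _ _ => hz⟩
      · exact ⟨0, fun _ h => absurd h hj⟩
    · exact ⟨0, fun h _ => absurd h hi⟩
  choose z hz using h2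
  -- a common radius `N₀`
  set N₀ : ℕ := Finset.univ.sup r ⊔
    Finset.univ.sup (fun ij : Fin m × Fin m => siteRad (z ij.1 ij.2)) with hN₀
  have hfin : ∀ i, (K i).Finite → K i ⊆ ↑(box d N₀) := fun i hi =>
    (hr i hi).trans (Finset.coe_subset.2 (box_mono d
      (le_sup_of_le_left (Finset.le_sup (f := r) (Finset.mem_univ i)))))
  have hinf : ∀ i j, (K i).Infinite → (K j).Infinite → (K i ∩ K j ∩ ↑(box d N₀)).Nonempty :=
    fun i j hi hj => ⟨z i j, hz i j hi hj, by
      rw [Finset.mem_coe, mem_box_iff_siteRad_le]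
      exact le_sup_of_le_right (Finset.le_sup
        (f := fun ij : Fin m × Fin m => siteRad (z ij.1 ij.2)) (Finset.mem_univ (i, j)))⟩
  -- the truncation error bound `b N → 0`
  set b : ℕ → ℝ := fun N => ∑ x ∈ box d N₀,
    (rcMeasure (finsetGraph (zdGraph d) (box d N)) (fkIsingParam (criticalBeta d)) 2
      (wiredBoundary (zdGraph d) (box d N))).real
      {ξ | ∃ a y : ↥(box d N), a.1 = x ∧ y ∈ wiredBoundary (zdGraph d) (box d N) ∧
        (openGraph ξ).Reachable a y} with hb
  have hb0 : Tendsto b atTop (𝓝 0) := by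
    have h := tendsto_finsetSum (box d N₀) fun x (_ : x ∈ box d N₀) =>
      tendsto_rcMeasure_real_siteArm_criticalBeta_box hd x
    simp only [Finset.sum_const_zero] at h
    exact h
  refine exists_tendsto_of_forall_eventually_abs_sub_le fun ε hε => ?_
  obtain ⟨N, hN₀N, hbN⟩ := ((eventually_ge_atTop N₀).and (hb0.eventually_lt_const hε)).exists
  -- the truncated probes are finite: their law converges
  obtain ⟨a, ha⟩ := tendsto_rcMeasure_real_connRelLaw_criticalBeta_box hd
    (K := fun i => K i ∩ ↑(box d N))
    (fun i => Or.inl ((box d N).finite_toSet.subset Set.inter_subset_right)) R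
  refine ⟨_, ⟨a, ha⟩, ?_⟩
  filter_upwards [eventually_ge_atTop N] with L hNL
  exact (abs_connRelLaw_sub_truncate_le hd0 hp one_le_two hfin hinf hN₀N hNL R).trans hbN.le

end Box

end Literature.Probability.LatticeModels

end
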